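import Literature.NumberTheory.EllipticCurves.Sprung2012.SharpFlatColemanKatoContragredient
import Literature.NumberTheory.EllipticCurves.Sprung2012.SharpFlatSelmerDualExistsProofs
import Literature.NumberTheory.EllipticCurves.Kato2004.IwasawaInvolutionTwistProofs
import Literature.NumberTheory.EllipticCurves.KatoFineSelmerDualTorsion
import Literature.NumberTheory.EllipticCurves.KatoFineSelmerFiniteProofs
import Literature.NumberTheory.EllipticCurves.IwasawaSelmerDualProofs
import Literature.NumberTheory.EllipticCurves.IwasawaAlgebraCharIdealProofs
import Literature.NumberTheory.EllipticCurves.IwasawaAlgebraDivisibilityProofs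
import Literature.NumberTheory.EllipticCurves.IwasawaAlgebraSpecializationLambdaTransferProofs
import Literature.NumberTheory.EllipticCurves.Rank1Residual.Predicates
import Literature.NumberTheory.EllipticCurves.ModularCurvePeriodRatio
import HarnessLib

/-!
# Crux `SprungLowerDivisibilityAtThree` (item stmt-BirchSwinnertonDyer-19875; x8 children 22569 / 22901 / 22570 / 23112),
# line `chromatic-common-zeros`: the registered stub F-α♮ `IotaDoor.stub_cokerBoundIotaOffT` is PACKAGE-FREE —
# «F-α♮ BY MASS»: the cokernel length of ANY Coleman–Kato package is pinned by the exact sequence (3) alone, so the stub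
# follows from ONE inequality between the local masses of the PINNED duals `X♯, X♭, X₀` and the torsion of `X₀`

Cell `bsd-ssimc` (host), width seat `cruxlead-stmt-BirchSwinnertonDyer-19875-w2` (gen 9) under the 19875 LEAD; `--supports`
stmt-BirchSwinnertonDyer-22569 `--as helper`; theorems only (no `def`, no named fact, no instance); Literature imports only
(route-independent); closes NO item. HONEST FRAMING: nothing about any curve is computed; the displayed hypotheses (MASS♮),
(M1), (M2) below are NOT proved here; K_spor, S4b-cyc, K1, leaf X8 and BSD are NOT proved by anything in this file.

## The observation (w2 g9)

The registered stub F-α♮ (`Cruxes/…/Lines/child22569_ledger_door.lean`, shared by 22901 / 22570 / 23112) bounds, for an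
ARBITRARY joint package `Cs, Cf : Sprung2012.SharpFlatColemanKatoData … I` over Kato's pinned `𝐇¹`, the local index
`min(ℓ_𝔭 Λ/range Cs.colMap, ℓ_𝔭 Λ/range Cf.colMap)` by the fine mass at the mirror prime `ℓ_{ι𝔭} Y.X`. The note COKER-w2g8 v5
recorded as the remaining obstacle that the package's `colMap` is EXISTENTIAL (reading flag `Sp12-714seq-eta1-maps-existential`),
so that the functional-model cokernel theorems (`…CokerBoundFunctionalModelHonda`, p662926) cannot be attached to it without an
identification `C•.colMap = Col^• ∘ loc`. THIS IS NOT AN OBSTACLE: the field `SharpFlatColemanKatoData.exact` — «`𝐇¹ →^{colMap}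
Λ → X^• → X₀ → 0` exact for every dual datum `D` of `Sel^•` and `Y` of `Sel₀`» — ALONE gives, by additivity of local lengths,
  `ℓ_𝔭(Λ ⧸ range C.colMap) + ℓ_𝔭 Y.X = ℓ_𝔭 D.X`   (§2, `SharpFlatColemanKatoData.lengthAt_cokernel_add_fine_eq`; no injectivity,
no `image_zeta_localized`, no identification of `colMap`; verbatim for the print-keyed twin `SharpFlatColemanKatoDataContra`).
Hence the cokernel length is an invariant of the PINNED duals, and (§3, `cokerBoundIotaOffT_of_massIota`) the stub — with its
registered signature VERBATIM as conclusion — follows from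
* (MASS♮) `min(ℓ_𝔭 X♯, ℓ_𝔭 X♭) ≤ ℓ_𝔭 X₀ + ℓ_{ι𝔭} X₀` at every height-one `𝔭 ∌ p, T`, for the tree's pinned dual data
  `SharpFlatSelmerDualData … ♯/♭`, `FineSelmerDualData κ γ` (displayed hypothesis `hMass`), and
* `X₀(E/ℚ_∞)` is `Λ`-torsion (the tree's named fact `Kato2004_fineSelmerDual_isTorsion`, Kato Thm. 12.4 (1) with (17.13.1)),
(MASS♮) being colMap-free, package-free and KEYING-IMMUNE as a `∀𝔭`-family: twisting every dual by `ι` turns MASS(𝔭) into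
MASS(ι𝔭), and the side conditions (height one, `∌ p`, `∌ T`) are `ι`-stable — so the same reduction serves the γ-keyed
registration and the print-keyed (`_contra`) port alike. In print MASS♮ is the composite (§4, `massIota_of_cotorsion_of_fine`):
* (M1) «chromatic excess ≤ cotorsion»: `min(ℓ_𝔭 X♯, ℓ_𝔭 X♭) ≤ ℓ_𝔭 X₀ + ℓ_𝔭 tors_Λ X(E/ℚ_∞)` — the joint Coleman sequence (SES-KP)
  `0 → H¹_Iw(ℚ_p,T) → Λ² → Λ/(T) → 0` (IN TREE unconditionally: `Sprung2012.exists_linearMap_isColemanPair_cokernel_of_hondaSystem_rat`,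
  w2 g8) + Poitou–Tate `0 → 𝐇¹ → H¹_Iw(ℚ_p,T) → X(E/ℚ_∞) → X₀ → 0` (Kato (17.13.1); Kobayashi 2003 Thm. 7.3) + Kato Thm. 12.4
  (`𝐇¹` torsion-free of rank one) + (3) per colour WITH ITS PRINTED MAPS: `ℓ_𝔭 X^• − ℓ_𝔭 X₀ = ord_𝔭 Col^•(loc h)` and
  `min_• ord_𝔭 Col^•(loc h) = ℓ_𝔭 tors(H¹_Iw/loc 𝐇¹) ≤ ℓ_𝔭 tors X(E/ℚ_∞)` — to TYPE (the functional-model skeleton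
  `min_lengthAt_quotient_range_le_lengthAt_torsion_of_functionalModel_of_hondaSystem` is its algebra);
* (M2) «cotorsion = fine mass at the mirror prime»: `ℓ_𝔭 tors_Λ X(E/ℚ_∞) ≤ ℓ_{ι𝔭} X₀` — Wingberg 1989 Cor. 2.5 / Matar 2020
  Thm. 1.1 `Ṫ_Λ(X) ∼ X₀` (typed this session as the named fact `matar2020_thm11_selmerDualTorsion_pseudoIso_fineSelmerDual`,
  proposal p664557; its discharge of (M2) is the companion file `…CokerBoundByMassMatar`).

## Contents
* §1 `lengthAt_quotient_range_add_eq_of_exact` — pure algebra: `H →ᶜ M →ʲ X →ᵏ Y → 0` exact ⟹ `ℓ_𝔭(M/range c) + ℓ_𝔭 Y = ℓ_𝔭 X`.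
* §2 `SharpFlatColemanKatoData.lengthAt_cokernel_add_fine_eq` (+ `…Contra…`), `…lengthAt_cokernel_le`,
  `min_lengthAt_cokernel_le_of_mass` (cancellation form at one prime).
* §3 `cokerBoundIotaOffT_of_massIota` — THE REGISTERED STUB SIGNATURE from (MASS♮) + `Kato2004_fineSelmerDual_isTorsion`.
* §4 `massIota_of_cotorsion_of_fine` — (MASS♮) ⟸ (M1) ∧ (M2) (fact-shaped telescopes); `cokerBoundIotaOffT_of_cotorsion_of_fine`.

References: [Sprung2012] Def. 7.11–7.13 (p. 1503–1504), Thm. 7.14 with exact sequence (3) (p. 1504), Prop. 7.19 (p. 1505), §7.1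
Props. 7.3/7.6; [Kato2004Asterisque] Thm. 12.4 (p. 221), (17.13.1) (p. 279–280); [Kobayashi2003] Prop. 7.1, Thm. 7.3 (pp. 12–13);
[KuriharaPollack2007] Prop. 1.2; [LeiSujatha2021] (SES-KP), (PT); [Wingberg1989] Cor. 2.5; [Matar2020] Thm. 1.1, Thm. 2.2;
[Washington1997] §13.2; [BourbakiAC5to7] VII §4.4–4.5; tree: `Sprung2012/{SharpFlatColemanKatoZeta, SharpFlatColemanKatoContragredient,
SharpFlatSelmerDualExistsProofs}`, `Kato2004/IwasawaInvolutionTwistProofs` (`fineSelmerDualData_lengthAt_inv_eq`, `height_comap_invol`),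
`KatoFineSelmerDualTorsion` (`Kato2004_fineSelmerDual_isTorsion`), `IwasawaAlgebra{CharIdeal,Divisibility}Proofs` (local lengths).
-/

set_option linter.dupNamespace false
set_option autoImplicit false

noncomputable section

open scoped Classical NumberField MatrixGroups ModularForm

open NumberField IsDedekindDomain CongruenceSubgroup WeierstrassCurve Field
  Literature.NumberTheory.EllipticCurves Literature.NumberTheory.EllipticCurves.ModularForms
  Literature.NumberTheory.EllipticCurves.ZpExtension Literature.NumberTheory.EllipticCurves.Sprung2017
  Literature.NumberTheory.EllipticCurves.Sprung2012 Literature.NumberTheory.EllipticCurves.Rank1Residual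
  Literature.NumberTheory.EllipticCurves.IwasawaAlgebra Literature.NumberTheory.EllipticCurves.Kato2004
  Literature.NumberTheory.EllipticCurves.Module

namespace Summit.BirchSwinnertonDyer.BirchSwinnertonDyer.Theorems.ChromaticCommonZeros

/-! ### §1 Pure algebra: the cokernel length in a four-term exact sequence -/

section Algebra

variable {R : Type*} [CommRing R] {H M X Y : Type*} [AddCommGroup H] [Module R H] [AddCommGroup M] [Module R M]
  [AddCommGroup X] [Module R X] [AddCommGroup Y] [Module R Y]

/-- **The cokernel length in `H →ᶜ M →ʲ X →ᵏ Y → 0`.** If the sequence is exact at `M` and at `X` and `k` is onto, then at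
every prime `𝔭`: `ℓ_𝔭(M ⧸ range c) + ℓ_𝔭 Y = ℓ_𝔭 X` (in `ℕ∞`; `M/range c = M/ker j ≅ range j = ker k` and `X/ker k ≅ Y`,
additivity of local lengths). No injectivity of `c` is used. [folklore] [cite: BourbakiAC5to7, VII §4.5 Prop. 10] -/
theorem lengthAt_quotient_range_add_eq_of_exact (c : H →ₗ[R] M) (j : M →ₗ[R] X) (k : X →ₗ[R] Y)
    (hcj : Function.Exact c j) (hjk : Function.Exact j k) (hk : Function.Surjective k) (𝔭 : PrimeSpectrum R) :
    Module.lengthAt R (M ⧸ LinearMap.range c) 𝔭 + Module.lengthAt R Y 𝔭 = Module.lengthAt R X 𝔭 := by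
  have h1 : LinearMap.range c = LinearMap.ker j := (LinearMap.exact_iff.mp hcj).symm
  have h2 : LinearMap.range j = LinearMap.ker k := (LinearMap.exact_iff.mp hjk).symm
  have e1 : (M ⧸ LinearMap.range c) ≃ₗ[R] LinearMap.range j :=
    (Submodule.quotEquivOfEq _ _ h1).trans j.quotKerEquivRange
  have e2 : (X ⧸ LinearMap.ker k) ≃ₗ[R] Y := k.quotKerEquivOfSurjective hk
  rw [lengthAt_eq_of_linearEquiv e1 𝔭, h2, ← lengthAt_eq_of_linearEquiv e2 𝔭]
  exact (lengthAt_eq_add_quotient (LinearMap.ker k) 𝔭).symm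

/-- Cancellation form at one prime: if `ℓ(M/range c•) + y = d•` for two maps `c♯, c♭` (the two colours), `y ≠ ⊤`, and
`min(d♯, d♭) ≤ y + z`, then `min(ℓ(M/range c♯), ℓ(M/range c♭)) ≤ z` (`ℕ∞` bookkeeping). [folklore] -/
theorem min_le_of_add_eq_of_min_le_add {a b y z ds df : ℕ∞} (hs : a + y = ds) (hf : b + y = df) (hy : y ≠ ⊤)
    (hmin : min ds df ≤ y + z) : min a b ≤ z := by
  rw [← hs, ← hf, min_add_add_right, add_comm y z] at hmin
  exact (WithTop.add_le_add_iff_right hy).mp hmin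

end Algebra

/-! ### §2 The package's cokernel length is pinned by the exact sequence (3) alone -/

section Package

variable {W : WeierstrassCurve ℚ} [W.IsElliptic] {p : ℕ} [Fact p.Prime]
  [ContinuousSMul ℤ_[p] (W.tateModule p)] [Module.Free ℤ_[p] (W.tateModule p)] [Module.Finite ℤ_[p] (W.tateModule p)]
  {N : ℕ} {f : CuspForm (Gamma0 N) 2} {ϖ : ℚ} {κ : ZpExtension ℚ p} {γ : absoluteGaloisGroup ℚ}
  {E : Type} [Field E] [Algebra ℚ E] {ι : AlgebraicClosure ℚ →ₐ[ℚ] AlgebraicClosure E} {ap : ℤ}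
  {g : absoluteGaloisGroup E} {c : ℕ → localPoints W E} {col : Chroma} {I : Kato2004.IwasawaH1Data W p κ γ}

/-- **The cokernel length of a ♯/♭ Coleman–Kato package is pinned by (3):** for ANY package datum `C` of colour `•` over Kato's
pinned `𝐇¹`, ANY dual datum `D` of `Sel^•(E/ℚ_∞)` and ANY dual datum `Y` of `Sel₀(ℚ_∞, E[p^∞])`, at every prime `𝔭` of `Λ`:
`ℓ_𝔭(Λ ⧸ range C.colMap) + ℓ_𝔭 Y.X = ℓ_𝔭 D.X` — from the field `exact` («`𝐇¹ →^{colMap} Λ → X^• → X₀ → 0` exact», Sprung 2012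
Thm. 7.14 (3) / Prop. 7.19) ALONE: no injectivity, no `image_zeta_localized`, no identification of the existential `colMap` with
`Col^• ∘ loc`. So `ℓ_𝔭(Λ ⧸ range C.colMap)` is an invariant of the pinned duals («the •-excess `ℓ_𝔭 X^• − ℓ_𝔭 X₀`»).
[cite: Sprung2012, Thm. 7.14 with exact sequence (3) (p. 1504), Prop. 7.19 (p. 1505)] [cite: BourbakiAC5to7, VII §4.5 Prop. 10] -/
theorem _root_.Literature.NumberTheory.EllipticCurves.Sprung2012.SharpFlatColemanKatoData.lengthAt_cokernel_add_fine_eq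
    (C : SharpFlatColemanKatoData W p f ϖ κ γ ι ap g c col I) (D : SharpFlatSelmerDualData W κ γ ι ap g c col)
    (Y : W.FineSelmerDualData κ γ) (𝔭 : PrimeSpectrum (IwasawaAlgebra p)) :
    Module.lengthAt (IwasawaAlgebra p) (IwasawaAlgebra p ⧸ LinearMap.range C.colMap) 𝔭 +
        Module.lengthAt (IwasawaAlgebra p) Y.X 𝔭 =
      Module.lengthAt (IwasawaAlgebra p) D.X 𝔭 := by
  obtain ⟨j, k, hcj, hjk, hk⟩ := C.exact D Y
  exact lengthAt_quotient_range_add_eq_of_exact C.colMap j k hcj hjk hk 𝔭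

/-- **Print-keyed twin** (for the C′ / `PrintX8VSC` port): the same identity for `SharpFlatColemanKatoDataContra`, whose field
`exact` quantifies over the dual data with their contragredient `Λ`-structure (key `γ⁻¹`):
`ℓ_𝔭(Λ ⧸ range C.colMap) + ℓ_𝔭 Y'.X = ℓ_𝔭 D'.X` for every `D' : SharpFlatSelmerDualData … γ⁻¹ …` and `Y' : FineSelmerDualData κ γ⁻¹`.
[cite: Sprung2012, Thm. 7.14 with exact sequence (3) (p. 1504), Prop. 7.19 (p. 1505)] [cite: BourbakiAC5to7, VII §4.5 Prop. 10] -/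
theorem _root_.Literature.NumberTheory.EllipticCurves.Sprung2012.SharpFlatColemanKatoDataContra.lengthAt_cokernel_add_fine_eq
    (C : SharpFlatColemanKatoDataContra W p f ϖ κ γ ι ap g c col I) (D' : SharpFlatSelmerDualData W κ γ⁻¹ ι ap g c col)
    (Y' : W.FineSelmerDualData κ γ⁻¹) (𝔭 : PrimeSpectrum (IwasawaAlgebra p)) :
    Module.lengthAt (IwasawaAlgebra p) (IwasawaAlgebra p ⧸ LinearMap.range C.colMap) 𝔭 +
        Module.lengthAt (IwasawaAlgebra p) Y'.X 𝔭 =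
      Module.lengthAt (IwasawaAlgebra p) D'.X 𝔭 := by
  obtain ⟨j, k, hcj, hjk, hk⟩ := C.exact D' Y'
  exact lengthAt_quotient_range_add_eq_of_exact C.colMap j k hcj hjk hk 𝔭

/-- The package's cokernel length is at most the chromatic mass: `ℓ_𝔭(Λ ⧸ range C.colMap) ≤ ℓ_𝔭 X^•` (any dual datum `D`;
a fine datum exists — `WeierstrassCurve.FineSelmerDualData` is inhabited for a topological generator — but only the
identity with ANY `Y` is needed, so `Y` is a parameter). [cite: Sprung2012, Thm. 7.14 with exact sequence (3) (p. 1504)] -/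
theorem _root_.Literature.NumberTheory.EllipticCurves.Sprung2012.SharpFlatColemanKatoData.lengthAt_cokernel_le
    (C : SharpFlatColemanKatoData W p f ϖ κ γ ι ap g c col I) (D : SharpFlatSelmerDualData W κ γ ι ap g c col)
    (Y : W.FineSelmerDualData κ γ) (𝔭 : PrimeSpectrum (IwasawaAlgebra p)) :
    Module.lengthAt (IwasawaAlgebra p) (IwasawaAlgebra p ⧸ LinearMap.range C.colMap) 𝔭 ≤
      Module.lengthAt (IwasawaAlgebra p) D.X 𝔭 := by
  rw [← C.lengthAt_cokernel_add_fine_eq D Y 𝔭]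
  exact le_self_add

/-- **F-α♮ AT ONE PRIME from the masses (cancellation form).** For two packages `Cs` (♯) and `Cf` (♭) over the same pinned `𝐇¹`,
dual data `Ds, Df` of `Sel♯, Sel♭`, a fine datum `Y` with `ℓ_𝔭 Y.X ≠ ⊤`, and ANY bound `z`:
`min(ℓ_𝔭 X♯, ℓ_𝔭 X♭) ≤ ℓ_𝔭 X₀ + z ⟹ min(ℓ_𝔭 Λ/range Cs.colMap, ℓ_𝔭 Λ/range Cf.colMap) ≤ z`. With `z = ℓ_{ι𝔭} X₀` this is the
registered stub's inequality at `𝔭`. [cite: Sprung2012, Thm. 7.14 with exact sequence (3) (p. 1504), Prop. 7.19 (p. 1505)] -/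
theorem min_lengthAt_cokernel_le_of_mass
    (Cs : SharpFlatColemanKatoData W p f ϖ κ γ ι ap g c Chroma.sharp I)
    (Cf : SharpFlatColemanKatoData W p f ϖ κ γ ι ap g c Chroma.flat I)
    (Ds : SharpFlatSelmerDualData W κ γ ι ap g c Chroma.sharp) (Df : SharpFlatSelmerDualData W κ γ ι ap g c Chroma.flat)
    (Y : W.FineSelmerDualData κ γ) (𝔭 : PrimeSpectrum (IwasawaAlgebra p))
    (hfin : Module.lengthAt (IwasawaAlgebra p) Y.X 𝔭 ≠ ⊤) {z : ℕ∞}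
    (hmass : min (Module.lengthAt (IwasawaAlgebra p) Ds.X 𝔭) (Module.lengthAt (IwasawaAlgebra p) Df.X 𝔭) ≤
      Module.lengthAt (IwasawaAlgebra p) Y.X 𝔭 + z) :
    min (Module.lengthAt (IwasawaAlgebra p) (IwasawaAlgebra p ⧸ LinearMap.range Cs.colMap) 𝔭)
        (Module.lengthAt (IwasawaAlgebra p) (IwasawaAlgebra p ⧸ LinearMap.range Cf.colMap) 𝔭) ≤ z :=
  min_le_of_add_eq_of_min_le_add (Cs.lengthAt_cokernel_add_fine_eq Ds Y 𝔭) (Cf.lengthAt_cokernel_add_fine_eq Df Y 𝔭)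
    hfin hmass

/-- The same for the print-keyed packages `SharpFlatColemanKatoDataContra` and the contragredient duals (key `γ⁻¹`).
[cite: Sprung2012, Thm. 7.14 with exact sequence (3) (p. 1504), Prop. 7.19 (p. 1505)] -/
theorem min_lengthAt_cokernel_le_of_mass_contra
    (Cs : SharpFlatColemanKatoDataContra W p f ϖ κ γ ι ap g c Chroma.sharp I)
    (Cf : SharpFlatColemanKatoDataContra W p f ϖ κ γ ι ap g c Chroma.flat I)
    (Ds : SharpFlatSelmerDualData W κ γ⁻¹ ι ap g c Chroma.sharp)
    (Df : SharpFlatSelmerDualData W κ γ⁻¹ ι ap g c Chroma.flat)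
    (Y' : W.FineSelmerDualData κ γ⁻¹) (𝔭 : PrimeSpectrum (IwasawaAlgebra p))
    (hfin : Module.lengthAt (IwasawaAlgebra p) Y'.X 𝔭 ≠ ⊤) {z : ℕ∞}
    (hmass : min (Module.lengthAt (IwasawaAlgebra p) Ds.X 𝔭) (Module.lengthAt (IwasawaAlgebra p) Df.X 𝔭) ≤
      Module.lengthAt (IwasawaAlgebra p) Y'.X 𝔭 + z) :
    min (Module.lengthAt (IwasawaAlgebra p) (IwasawaAlgebra p ⧸ LinearMap.range Cs.colMap) 𝔭)
        (Module.lengthAt (IwasawaAlgebra p) (IwasawaAlgebra p ⧸ LinearMap.range Cf.colMap) 𝔭) ≤ z :=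
  min_le_of_add_eq_of_min_le_add (Cs.lengthAt_cokernel_add_fine_eq Ds Y' 𝔭) (Cf.lengthAt_cokernel_add_fine_eq Df Y' 𝔭)
    hfin hmass

end Package


/-! ### §3 THE REGISTERED STUB F-α♮ from (MASS♮) and the torsion of `X₀` -/

section Stub

/-- **F-α♮ BY MASS — the registered stub `IotaDoor.stub_cokerBoundIotaOffT` (children 22569 / 22901 / 22570 / 23112 of crux
`SprungLowerDivisibilityAtThree`), ITS SIGNATURE VERBATIM AS CONCLUSION, from two displayed pinned-object inputs:**
(MASS♮) `hMass` — on class X8, in the cyclotomic/Honda frame of the stub, for EVERY pair of dual data `Ds, Df` of `Sel♯, Sel♭`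
and EVERY fine datum `Y` (all keyed by the topological generator `γ`), at every height-one `𝔭 ∌ p, T`:
`min(ℓ_𝔭 Ds.X, ℓ_𝔭 Df.X) ≤ ℓ_𝔭 Y.X + ℓ_{ι𝔭} Y.X`, `ι𝔭 = comap (invol p) 𝔭` — and the tree's named fact
`Kato2004_fineSelmerDual_isTorsion` (`X₀(E/ℚ_∞)` is `Λ`-torsion; with `FineSelmerDualData.module_finite` it makes `ℓ_𝔭 X₀`
finite at height one). Proof: dual data `Ds, Df` exist (`Sprung2012.nonempty_sharpFlatSelmerDualData'`); §2 pins
`ℓ_𝔭(Λ/range C•.colMap) + ℓ_𝔭 Y.X = ℓ_𝔭 D•.X` for the stub's ARBITRARY packages `Cs, Cf`; cancel `ℓ_𝔭 Y.X`. The newform, the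
Sprung pair, `Cs.Z = Cf.Z`, `IsCyclotomicVariable` and the common-zero hypothesis of the stub are NOT used (F-α♮ holds at every
height-one prime off `(p), (T)`). (MASS♮) is colMap-free, package-free and keying-immune as a `∀𝔭`-family (module docstring);
in print it is (SES-KP) + Poitou–Tate + Kato Thm. 12.4 + Wingberg/Matar (§4 splits it as (M1) ∧ (M2)). CONDITIONAL on `hMass`
and on the named fact; nothing else. [cite: Sprung2012, Thm. 7.14 with exact sequence (3) (p. 1504), Prop. 7.19 (p. 1505)]
[cite: Kato2004Asterisque, Thm. 12.4 (p. 221), (17.13.1) (p. 279)] [cite: Wingberg1989, Cor. 2.5] [cite: Matar2020, Thm. 1.1]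
[cite: KuriharaPollack2007, Prop. 1.2] [cite: LeiSujatha2021, (SES-KP), (PT)] -/
theorem cokerBoundIotaOffT_of_massIota
    (hMass : ∀ (W : WeierstrassCurve ℚ) [W.IsElliptic] [W.IsGloballyMinimal] (p : ℕ) [Fact p.Prime],
      ClassX8 W p → ∀ (κ : ZpExtension ℚ p) (γ : Field.absoluteGaloisGroup ℚ),
      κ.IsCyclotomic → κ.IsTopGenerator γ →
    ∀ (v : HeightOneSpectrum (𝓞 ℚ)), (p : 𝓞 ℚ) ∈ v.asIdeal →
    ∀ (g : Field.absoluteGaloisGroup (v.adicCompletion ℚ)),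
      κ.IsTopGenerator (resGalOfEmb (closureEmb (K := ℚ) (v.adicCompletion ℚ)) g) →
    ∀ (cneg : localPoints W (v.adicCompletion ℚ)) (c : ℕ → localPoints W (v.adicCompletion ℚ)),
      IsHondaSystem κ (closureEmb (K := ℚ) (v.adicCompletion ℚ)) W (W.frobeniusTrace p) g cneg c →
    ∀ (Ds : SharpFlatSelmerDualData W κ γ (closureEmb (K := ℚ) (v.adicCompletion ℚ)) (W.frobeniusTrace p) g c
        Chroma.sharp)
      (Df : SharpFlatSelmerDualData W κ γ (closureEmb (K := ℚ) (v.adicCompletion ℚ)) (W.frobeniusTrace p) g c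
        Chroma.flat)
      (Y : W.FineSelmerDualData κ γ) (𝔭 : PrimeSpectrum (IwasawaAlgebra p)), 𝔭.asIdeal.height = 1 →
      (p : IwasawaAlgebra p) ∉ 𝔭.asIdeal → (PowerSeries.X : IwasawaAlgebra p) ∉ 𝔭.asIdeal →
      min (Module.lengthAt (IwasawaAlgebra p) Ds.X 𝔭) (Module.lengthAt (IwasawaAlgebra p) Df.X 𝔭) ≤
        Module.lengthAt (IwasawaAlgebra p) Y.X 𝔭 +
          Module.lengthAt (IwasawaAlgebra p) Y.X (PrimeSpectrum.comap (invol p).toRingHom 𝔭))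
    (hfine : Kato2004_fineSelmerDual_isTorsion) :
    ∀ (W : WeierstrassCurve ℚ) [W.IsElliptic] [W.IsGloballyMinimal] (p : ℕ) [Fact p.Prime]
      [ContinuousSMul ℤ_[p] (W.tateModule p)] [Module.Free ℤ_[p] (W.tateModule p)]
      [Module.Finite ℤ_[p] (W.tateModule p)],
      ClassX8 W p → ∀ (κ : ZpExtension ℚ p) (γ : Field.absoluteGaloisGroup ℚ),
      κ.IsCyclotomic → κ.IsTopGenerator γ → IsCyclotomicVariable p γ →
    ∀ (v : HeightOneSpectrum (𝓞 ℚ)), (p : 𝓞 ℚ) ∈ v.asIdeal →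
    ∀ (g : Field.absoluteGaloisGroup (v.adicCompletion ℚ)),
      κ.IsTopGenerator (resGalOfEmb (closureEmb (K := ℚ) (v.adicCompletion ℚ)) g) →
    ∀ (cneg : localPoints W (v.adicCompletion ℚ)) (c : ℕ → localPoints W (v.adicCompletion ℚ)),
      IsHondaSystem κ (closureEmb (K := ℚ) (v.adicCompletion ℚ)) W (W.frobeniusTrace p) g cneg c →
    ∀ (N : ℕ) (_ : NeZero N) (f : CuspForm (Gamma0 N) 2) (ϖ : ℚ) (Lsharp Lflat : IwasawaAlgebra p),
      IsNewformOf W f → (ϖ : ℝ) * W.realPeriodRat = plusPeriod f →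
      IsSprungPair f p (W.frobeniusTrace p) Lsharp Lflat →
    ∀ (I : Kato2004.IwasawaH1Data W p κ γ)
      (Cs : SharpFlatColemanKatoData W p f ϖ κ γ (closureEmb (K := ℚ) (v.adicCompletion ℚ))
        (W.frobeniusTrace p) g c Chroma.sharp I)
      (Cf : SharpFlatColemanKatoData W p f ϖ κ γ (closureEmb (K := ℚ) (v.adicCompletion ℚ))
        (W.frobeniusTrace p) g c Chroma.flat I),
      Cs.Z = Cf.Z →
    ∀ (Y : W.FineSelmerDualData κ γ) (𝔭 : PrimeSpectrum (IwasawaAlgebra p)), 𝔭.asIdeal.height = 1 →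
      (p : IwasawaAlgebra p) ∉ 𝔭.asIdeal → (PowerSeries.X : IwasawaAlgebra p) ∉ 𝔭.asIdeal →
      (∀ (col' : Chroma) (G' : IwasawaAlgebra p),
        iwasawaToPowerSeries p G' =
          PowerSeries.C (ϖ : ℚ_[p]) * iwasawaToPowerSeries p (chromaticL col' Lsharp Lflat) →
        G' ∈ 𝔭.asIdeal) →
      min (Module.lengthAt (IwasawaAlgebra p) (IwasawaAlgebra p ⧸ LinearMap.range Cs.colMap) 𝔭)
          (Module.lengthAt (IwasawaAlgebra p) (IwasawaAlgebra p ⧸ LinearMap.range Cf.colMap) 𝔭) ≤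
        Module.lengthAt (IwasawaAlgebra p) Y.X (PrimeSpectrum.comap (invol p).toRingHom 𝔭) := by
  intro W _ _ p _ _ _ _ hX κ γ hκ hγ _hcv v hv g hg cneg c hH N _ f ϖ Lsharp Lflat _hnew _hϖ _hSP I Cs Cf _hZ Y 𝔭 h𝔭
    hp𝔭 hT𝔭 _hzero
  obtain ⟨Ds⟩ := nonempty_sharpFlatSelmerDualData' W κ (closureEmb (K := ℚ) (v.adicCompletion ℚ))
    (W.frobeniusTrace p) g c Chroma.sharp γ
  obtain ⟨Df⟩ := nonempty_sharpFlatSelmerDualData' W κ (closureEmb (K := ℚ) (v.adicCompletion ℚ))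
    (W.frobeniusTrace p) g c Chroma.flat γ
  have hfin : Module.lengthAt (IwasawaAlgebra p) Y.X 𝔭 ≠ ⊤ := by
    haveI := WeierstrassCurve.FineSelmerDualData.module_finite W κ hγ Y
    exact IwasawaAlgebra.lengthAt_ne_top_of_isTorsion_of_height_le_one p Y.X (hfine W p κ γ hκ hγ Y) 𝔭 h𝔭.le
  exact min_lengthAt_cokernel_le_of_mass Cs Cf Ds Df Y 𝔭 hfin
    (hMass W p hX κ γ hκ hγ v hv g hg cneg c hH Ds Df Y 𝔭 h𝔭 hp𝔭 hT𝔭)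

end Stub

/-! ### §4 (MASS♮) ⟸ (M1) «chromatic excess ≤ cotorsion» ∧ (M2) «cotorsion ≤ fine mass at the mirror prime» -/

section Split

/-- **(MASS♮) from its two printed halves**, both displayed as fact-shaped telescopes over the pinned duals, with the dual
`X(E/ℚ_∞) = Sel_{p^∞}(E/ℚ_∞)^∨` (`WeierstrassCurve.SelmerDualData W κ γ`, inhabited by `WeierstrassCurve.selmerDualData`) as the
intermediate object:
(M1) `hM1` — «chromatic excess ≤ cotorsion»: `min(ℓ_𝔭 X♯, ℓ_𝔭 X♭) ≤ ℓ_𝔭 X₀ + ℓ_𝔭 tors_Λ X(E/ℚ_∞)` at every height-one `𝔭 ∌ p, T`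
(print: (SES-KP) Kurihara–Pollack / Sprung §7.1 / Lei–Sujatha — IN TREE —, Poitou–Tate Kato (17.13.1) / Kobayashi Thm. 7.3, Kato
Thm. 12.4, and Sprung's (3) per colour: `ℓ_𝔭 X^• − ℓ_𝔭 X₀ = ord_𝔭 Col^•(loc h)`, `min_• = ℓ_𝔭 tors(H¹_Iw/loc 𝐇¹) ≤ ℓ_𝔭 tors X`);
(M2) `hM2` — «cotorsion ≤ fine mass at the mirror prime»: `ℓ_𝔭 tors_Λ X(E/ℚ_∞) ≤ ℓ_{ι𝔭} X₀` at every height-one `𝔭 ∌ p`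
(Wingberg 1989 Cor. 2.5 / Matar 2020 Thm. 1.1: `Ṫ_Λ(X) ∼ X₀`; typed as `matar2020_thm11_selmerDualTorsion_pseudoIso_fineSelmerDual`).
Both are keying-immune as `∀𝔭`-families. [cite: Kato2004Asterisque, Thm. 12.4 (p. 221), (17.13.1) (p. 279)]
[cite: Kobayashi2003, Prop. 7.1 and Thm. 7.3 (pp. 12–13)] [cite: Sprung2012, §7.1 Props. 7.3/7.6, Thm. 7.14 (3) (p. 1504)]
[cite: KuriharaPollack2007, Prop. 1.2] [cite: LeiSujatha2021, (SES-KP), (PT)] [cite: Wingberg1989, Cor. 2.5] [cite: Matar2020, Thm. 1.1] -/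
theorem massIota_of_cotorsion_of_fine
    (hM1 : ∀ (W : WeierstrassCurve ℚ) [W.IsElliptic] [W.IsGloballyMinimal] (p : ℕ) [Fact p.Prime],
      ClassX8 W p → ∀ (κ : ZpExtension ℚ p) (γ : Field.absoluteGaloisGroup ℚ),
      κ.IsCyclotomic → κ.IsTopGenerator γ →
    ∀ (v : HeightOneSpectrum (𝓞 ℚ)), (p : 𝓞 ℚ) ∈ v.asIdeal →
    ∀ (g : Field.absoluteGaloisGroup (v.adicCompletion ℚ)),
      κ.IsTopGenerator (resGalOfEmb (closureEmb (K := ℚ) (v.adicCompletion ℚ)) g) →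
    ∀ (cneg : localPoints W (v.adicCompletion ℚ)) (c : ℕ → localPoints W (v.adicCompletion ℚ)),
      IsHondaSystem κ (closureEmb (K := ℚ) (v.adicCompletion ℚ)) W (W.frobeniusTrace p) g cneg c →
    ∀ (S : W.SelmerDualData κ γ)
      (Ds : SharpFlatSelmerDualData W κ γ (closureEmb (K := ℚ) (v.adicCompletion ℚ)) (W.frobeniusTrace p) g c
        Chroma.sharp)
      (Df : SharpFlatSelmerDualData W κ γ (closureEmb (K := ℚ) (v.adicCompletion ℚ)) (W.frobeniusTrace p) g c
        Chroma.flat)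
      (Y : W.FineSelmerDualData κ γ) (𝔭 : PrimeSpectrum (IwasawaAlgebra p)), 𝔭.asIdeal.height = 1 →
      (p : IwasawaAlgebra p) ∉ 𝔭.asIdeal → (PowerSeries.X : IwasawaAlgebra p) ∉ 𝔭.asIdeal →
      min (Module.lengthAt (IwasawaAlgebra p) Ds.X 𝔭) (Module.lengthAt (IwasawaAlgebra p) Df.X 𝔭) ≤
        Module.lengthAt (IwasawaAlgebra p) Y.X 𝔭 +
          Module.lengthAt (IwasawaAlgebra p) (Submodule.torsion (IwasawaAlgebra p) S.X) 𝔭)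
    (hM2 : ∀ (W : WeierstrassCurve ℚ) [W.IsElliptic] [W.IsGloballyMinimal] (p : ℕ) [Fact p.Prime],
      ClassX8 W p → ∀ (κ : ZpExtension ℚ p) (γ : Field.absoluteGaloisGroup ℚ),
      κ.IsCyclotomic → κ.IsTopGenerator γ →
    ∀ (S : W.SelmerDualData κ γ) (Y : W.FineSelmerDualData κ γ) (𝔭 : PrimeSpectrum (IwasawaAlgebra p)),
      𝔭.asIdeal.height = 1 → (p : IwasawaAlgebra p) ∉ 𝔭.asIdeal →
      Module.lengthAt (IwasawaAlgebra p) (Submodule.torsion (IwasawaAlgebra p) S.X) 𝔭 ≤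
        Module.lengthAt (IwasawaAlgebra p) Y.X (PrimeSpectrum.comap (invol p).toRingHom 𝔭)) :
    ∀ (W : WeierstrassCurve ℚ) [W.IsElliptic] [W.IsGloballyMinimal] (p : ℕ) [Fact p.Prime],
      ClassX8 W p → ∀ (κ : ZpExtension ℚ p) (γ : Field.absoluteGaloisGroup ℚ),
      κ.IsCyclotomic → κ.IsTopGenerator γ →
    ∀ (v : HeightOneSpectrum (𝓞 ℚ)), (p : 𝓞 ℚ) ∈ v.asIdeal →
    ∀ (g : Field.absoluteGaloisGroup (v.adicCompletion ℚ)),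
      κ.IsTopGenerator (resGalOfEmb (closureEmb (K := ℚ) (v.adicCompletion ℚ)) g) →
    ∀ (cneg : localPoints W (v.adicCompletion ℚ)) (c : ℕ → localPoints W (v.adicCompletion ℚ)),
      IsHondaSystem κ (closureEmb (K := ℚ) (v.adicCompletion ℚ)) W (W.frobeniusTrace p) g cneg c →
    ∀ (Ds : SharpFlatSelmerDualData W κ γ (closureEmb (K := ℚ) (v.adicCompletion ℚ)) (W.frobeniusTrace p) g c
        Chroma.sharp)
      (Df : SharpFlatSelmerDualData W κ γ (closureEmb (K := ℚ) (v.adicCompletion ℚ)) (W.frobeniusTrace p) g c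
        Chroma.flat)
      (Y : W.FineSelmerDualData κ γ) (𝔭 : PrimeSpectrum (IwasawaAlgebra p)), 𝔭.asIdeal.height = 1 →
      (p : IwasawaAlgebra p) ∉ 𝔭.asIdeal → (PowerSeries.X : IwasawaAlgebra p) ∉ 𝔭.asIdeal →
      min (Module.lengthAt (IwasawaAlgebra p) Ds.X 𝔭) (Module.lengthAt (IwasawaAlgebra p) Df.X 𝔭) ≤
        Module.lengthAt (IwasawaAlgebra p) Y.X 𝔭 +
          Module.lengthAt (IwasawaAlgebra p) Y.X (PrimeSpectrum.comap (invol p).toRingHom 𝔭) := by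
  intro W _ _ p _ hX κ γ hκ hγ v hv g hg cneg c hH Ds Df Y 𝔭 h𝔭 hp𝔭 hT𝔭
  set S : W.SelmerDualData κ γ := W.selmerDualData κ hγ
  exact (hM1 W p hX κ γ hκ hγ v hv g hg cneg c hH S Ds Df Y 𝔭 h𝔭 hp𝔭 hT𝔭).trans
    (add_le_add le_rfl (hM2 W p hX κ γ hκ hγ S Y 𝔭 h𝔭 hp𝔭))

end Split

end Summit.BirchSwinnertonDyer.BirchSwinnertonDyer.Theorems.ChromaticCommonZeros

end
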